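import Summits.SmoothPoincare4.SmoothPoincare4.Theorems.ConvexBisectionAcyclicBisectionExistsHgapStraighten
import Summits.SmoothPoincare4.SmoothPoincare4.Theorems.ConvexBisectionAcyclicBisectionExistsHgapShadow
import Summits.SmoothPoincare4.SmoothPoincare4.Theorems.ConvexBisectionAcyclicBisectionExistsDualSignPin
import Summits.SmoothPoincare4.SmoothPoincare4.Theorems.ConvexBisectionAcyclicBisectionExistsDualLinkFraming
import HarnessLib

/-!
# Dual handles, node Hgap ("T3c-3 WITH DATA"), part A-2: the FIBRED STRAIGHTENED dual presentation —
# transport of the dual data along the universal straightening, with the `w`-bridges, pages and shadows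
(sub-goal of stub `stub_T3_dualPresentation` (T3), line `modp-braid-orbits`, crux
`ConvexBisection.AcyclicBisectionExists`, item stmt-SmoothPoincare4-10508; wave 6, lead c5, worker G1;
registered sub-goal `helper_transport_bridges`; the statement consumed by the Hgap assembly (worker G3)
is `Hgap_transport`, riding along)

T3 needs ONE presentation `(q₂, D₂p)` of the complement piece `W₂` over the cap `Base g` which is both
positive allowable (pages, shadows, twisting) and `θ`-compatible with the seam (X2-REPORT §2.1): it must
come from X1's dual data `D₂` (handles attached along the dual maps
`dualMap D bX (bBase g) Ψ col κ δ … (|P| + j)`) by TRANSPORT along a `w`-proportional diffeomorphism of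
the cap.  Here:

* §1 `transport_bridges` (registered as `helper_transport_bridges`): transport of multi-attachment DATA
  along ANY diffeomorphism `G` of the cap with `w ∘ G = r · w`, `r > 0` (X4's
  `exists_multiAttachmentData_transport`: `D₂p.jA = D₂.jA ∘ G⁻¹` on the cores complements,
  `D₂p.jB = D₂.jB`) together with the two bridges of Hgap: (R1p) every new unsurgered point `ap` is an
  old one `a' = G⁻¹ ap` with `D₂p.jA ap = D₂.jA a'` and `w ap = c · w a'`, `c > 0`; (R2p) every old
  unsurgered point is reached.
* §2 `Hgap_transport`: with `G` the time-`1` map of X3's universal straightening `strIso g m hm` at the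
  margin `m` of `helper_dual_straighten` (`…HgapStraighten.lean`: `2m ≤ ‖w‖` on the dual circles, all
  dual circles flattened into `page g (pageDir |P ++ N| (|P| + j))`), the transported dual presentation
  has: the `jA`-formula, flat pages, non-zero shadows (`…HgapShadow.lean`, needs `∀ x ∈ N, x.1 ≠ 0`),
  and the bridges (R1p), (R2p) in the verbatim shape of Hgap.  The inverse of the time-`1` map is the
  time-`(-1)` map (`str_toDiffeomorph_one_symm_apply`), so the seam correspondence of `D₂p` is
  `S₁ ∘ (that of D₂)` — the input of the orientation-character clause (worker G3) and, through
  `attachingCircle_transport` / `attachingFraming_transport`, of the twisting clause (worker G2).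

Everything is proved; no named facts, no `sorry`, no `def`.

## References
* R. İ. Baykur, *Kähler decomposition of 4-manifolds*, AGT 6 (2006), proof of Thm. 5.1, pp. 13–14. [Baykur2006]
* A. A. Kosinski, *Differential Manifolds* (1993), VI §6 and VIII, proof of (1.2). [Kosinski1993]
-/

noncomputable section

-- the prescribed namespace `Summit.<P>.<Sub>.…` duplicates `SmoothPoincare4` (P = Sub)
set_option linter.dupNamespace false

open scoped Manifold ContDiff Topology

namespace Summit.SmoothPoincare4.SmoothPoincare4.Theorems.AcyclicBisectionExists.ModpBraidOrbits

open Set Function Metric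
open Literature.Topology.FourManifolds Literature.Topology.FourManifolds.HandleAttachingMap
  Literature.Topology.FourManifolds.LefschetzBase

namespace HgapTransport

variable {g : ℕ}

/-! ## §1 Transport of multi-attachment data along a `w`-proportional diffeomorphism of the cap -/

/-- **Transport with bridges**: for handles attached to the cap along `q` with data `D₂` on `W₂` and a
diffeomorphism `G` of the cap with `w (G x) = r · w x`, `r > 0`, the data `D₂p` of the attachment along
`G ∘ q` (X4's `exists_multiAttachmentData_transport`) satisfies `D₂p.jA = D₂.jA ∘ G⁻¹`, `D₂p.jB = D₂.jB`,
and the two bridges (R1p), (R2p) of the node Hgap. [cite: Kosinski1993, VI §6 and VIII proof of (1.2)] -/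
theorem transport_bridges {ι : Type} [Finite ι] (q : ι → HandleAttachingMap 3 2 (Base g))
    {W₂ : Type} [TopologicalSpace W₂] [ChartedSpace (EuclideanHalfSpace 4) W₂]
    (D₂ : MultiAttachmentData q (𝓡∂ 4) W₂) (G : Base g ≃ₘ⟮𝓡∂ 4, 𝓡∂ 4⟯ Base g)
    (hw : ∀ x : Base g, ∃ r : ℝ, 0 < r ∧ w g (G x).1 = (r : ℂ) * w g x.1) :
    ∃ D₂p : MultiAttachmentData (fun i => (q i).transport G) (𝓡∂ 4) W₂,
      (∀ a, D₂p.jA a = D₂.jA (coresComplementCongr q G a)) ∧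
      (∀ i b, D₂p.jB i b = D₂.jB i b) ∧
      (∀ ap : ↥(coresComplement fun i => (q i).transport G), ∃ (a' : ↥(coresComplement q)) (c : ℝ),
        0 < c ∧ D₂p.jA ap = D₂.jA a' ∧ w g (ap : Base g).1 = (c : ℂ) * w g (a' : Base g).1) ∧
      (∀ a' : ↥(coresComplement q), ∃ ap : ↥(coresComplement fun i => (q i).transport G),
        D₂p.jA ap = D₂.jA a') := by
  obtain ⟨D₂p, hA, hB⟩ := exists_multiAttachmentData_transport D₂ G
  refine ⟨D₂p, hA, hB, fun ap => ?_, fun a' => ?_⟩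
  · -- (R1p): `a' := G⁻¹ ap`, `w ap = w (G (G⁻¹ ap)) = r · w (G⁻¹ ap)`
    obtain ⟨r, hr, hwr⟩ := hw (G.symm (ap : Base g))
    rw [G.apply_symm_apply] at hwr
    exact ⟨coresComplementCongr q G ap, r, hr, hA ap, hwr⟩
  · -- (R2p): `ap := G a'`
    refine ⟨(coresComplementCongr q G).symm a', ?_⟩
    rw [hA, Diffeomorph.apply_symm_apply]

/-! ## §2 The inverse of the time-`1` map of the universal straightening -/

/-- `S_1 ∘ S_{-1} = id` for X3's universal straightening (flow property). [folklore] -/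
theorem str_right_inv (m : ℝ) (hm : 0 < m) (x : Base g) :
    (strIso g m hm).toFun 1 ((strIso g m hm).toFun (-1) x) = x :=
  straighten_right_inv (strIso g m hm) (strFlow g m hm) (str_zero m hm) (str_add m hm) (str_coe m hm) x

/-- **The inverse of the time-`1` map of the universal straightening is its time-`(-1)` map.**
[folklore] -/
theorem str_toDiffeomorph_one_symm_apply (m : ℝ) (hm : 0 < m) (x : Base g) :
    ((strIso g m hm).toDiffeomorph 1).symm x = (strIso g m hm).toFun (-1) x := by
  have h1 : ((strIso g m hm).toDiffeomorph 1) ((strIso g m hm).toFun (-1) x) = x := str_right_inv m hm x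
  conv_lhs => rw [← h1]
  rw [Diffeomorph.symm_apply_apply]

/-- The `jA`-formula of the transport along the time-`1` map, read with the time-`(-1)` map:
`(coresComplementCongr q (S.toDiffeomorph 1) a : Base g) = S_{-1} a`. [folklore] -/
theorem coe_coresComplementCongr_str {ι : Type} [Finite ι] (q : ι → HandleAttachingMap 3 2 (Base g))
    (m : ℝ) (hm : 0 < m) (a : ↥(coresComplement fun i => (q i).transport ((strIso g m hm).toDiffeomorph 1))) :
    ((coresComplementCongr q ((strIso g m hm).toDiffeomorph 1) a : ↥(coresComplement q)) : Base g) =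
      (strIso g m hm).toFun (-1) a := by
  rw [coe_coresComplementCongr, str_toDiffeomorph_one_symm_apply]

/-! ## §2b The new framed attaching circles, explicitly (the objects of the twisting clause) -/

section Framed

variable {X : Type} [TopologicalSpace X] [ChartedSpace (EuclideanHalfSpace 4) X] [IsManifold (𝓡∂ 4) ∞ X]
  {ι : Type} [Finite ι] {h : ι → HandleAttachingMap 3 2 (Base g)}

/-- **The transported dual attaching circle is `G` of the seam push of the belt circle**:
`((dualMap … k).transport G).attachingCircle θ = G (incl (seamDiffeo bX (bBase g) Ψ (belt circle θ)))`
(`attachingCircle_transport`, `attachingCircle_pushedMap`). [cite: Kosinski1993, VI §6 and VIII proof of (1.2)] -/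
theorem transport_dualMap_attachingCircle (D : MultiAttachmentData h (𝓡∂ 4) X) (bX : BoundaryData (𝓡∂ 4) X (𝓡 3))
    (Ψ : bX.carrier ≃ₘ⟮𝓡 3, 𝓡 3⟯ (bBase g).carrier) (col : (BoundaryManifold.boundaryData 3 (Base g)).Collar)
    (κ δ : ℝ) (hκ : 0 < κ) (hκ1 : κ ≤ 1) (hδ : 0 < δ) (hδ2 : δ ≤ 1 / 2)
    (G : Base g ≃ₘ⟮𝓡∂ 4, 𝓡∂ 4⟯ Base g) (k : ι) (θ : sphere (0 : EuclideanSpace ℝ (Fin 2)) 1) :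
    ((dualMap D bX (bBase g) Ψ col κ δ hκ hκ1 hδ hδ2 k).transport G).attachingCircle θ =
      G ((BoundaryManifold.boundaryData 3 (Base g)).incl (seamDiffeo bX (bBase g) Ψ
        ⟨(beltMap D k).attachingCircle θ, (beltMap D k).isBoundaryPoint_attachingCircle θ⟩)) := by
  rw [attachingCircle_transport_apply]
  exact congrArg G (attachingCircle_pushedMap (beltMap D k) (seamDiffeo bX (bBase g) Ψ) col κ δ hκ hκ1 hδ hδ2 θ)

/-- **The transported dual handle framing is `dG` of `κ •` the seam push of the belt framing**:
`((dualMap … k).transport G).attachingFraming θ = dG_{dual circle θ} (κ • d(incl ∘ seamDiffeo)(tail (belt framing θ)))`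
(`attachingFraming_transport`, Z7's `helper_attachingFraming_dualMap`). [cite: Kosinski1993, VI §6 and VIII proof of (1.2)] -/
theorem transport_dualMap_attachingFraming (D : MultiAttachmentData h (𝓡∂ 4) X) (bX : BoundaryData (𝓡∂ 4) X (𝓡 3))
    (Ψ : bX.carrier ≃ₘ⟮𝓡 3, 𝓡 3⟯ (bBase g).carrier) (col : (BoundaryManifold.boundaryData 3 (Base g)).Collar)
    (κ δ : ℝ) (hκ : 0 < κ) (hκ1 : κ ≤ 1) (hδ : 0 < δ) (hδ2 : δ ≤ 1 / 2)
    (G : Base g ≃ₘ⟮𝓡∂ 4, 𝓡∂ 4⟯ Base g) (k : ι) (θ : sphere (0 : EuclideanSpace ℝ (Fin 2)) 1) :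
    ((dualMap D bX (bBase g) Ψ col κ δ hκ hκ1 hδ hδ2 k).transport G).attachingFraming θ =
      mfderiv (𝓡∂ 4) (𝓡∂ 4) G ((dualMap D bX (bBase g) Ψ col κ δ hκ hκ1 hδ hδ2 k).attachingCircle θ)
        (κ • mfderiv (𝓡 3) (𝓡∂ 4)
          (fun y => (BoundaryManifold.boundaryData 3 (Base g)).incl (seamDiffeo bX (bBase g) Ψ y))
          ⟨(beltMap D k).attachingCircle θ, (beltMap D k).isBoundaryPoint_attachingCircle θ⟩
          (BoundaryManifold.tail 3 ((beltMap D k).attachingFraming θ))) := by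
  rw [attachingFraming_transport, helper_attachingFraming_dualMap D bX (bBase g) Ψ col κ δ hκ hκ1 hδ hδ2 k θ]

end Framed

end HgapTransport

open HgapStraighten HgapShadow HgapTransport

/-! ## §3 The fibred straightened dual presentation (the statement consumed by the Hgap assembly) -/

/-- **Hgap, part A: the FIBRED STRAIGHTENED dual presentation.**  For the T3 telescope (a fibred model
`(X, h, D, bX, Ψ)` of the Lefschetz link `P ++ N` over `Base g`, X1's dual data `D₂` of the suffix handles
on `W₂`) and `∀ x ∈ N, x.1 ≠ 0`: there are a margin `m > 0` (`2m ≤ ‖w‖` on the dual circles) and data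
`D₂p` of `W₂` along the dual maps TRANSPORTED by the time-`1` map of X3's universal straightening
`strIso g m hm` (`rho`-preserving, `w`-proportional: `str_rho_base`, `str_dir_base`) with
`D₂p.jA = D₂.jA ∘ S_{-1}` (`coresComplementCongr`, `coe_coresComplementCongr_str`), `D₂p.jB = D₂.jB`, all
transported attaching circles in the FLAT pages `page g (pageDir |P ++ N| (|P| + j))`, non-zero shadows,
and the bridges (R1p), (R2p) of Hgap verbatim.  The new framed attaching circles are
`S_1 ∘ (dual circle)` and `dS_1 (dual framing)` (`attachingCircle_transport`,
`attachingFraming_transport`; dual circle/framing: `attachingCircle_dualMap`,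
`helper_attachingFraming_dualMap`). [cite: Baykur2006, Thm. 5.1 (proof, pp. 13–14)] -/
theorem Hgap_transport (g : ℕ) (P N : List ((Fin g ⊕ Fin g → ℤ) × Bool))
    (h : Fin (P ++ N).length → HandleAttachingMap 3 2 (Base g)) (hlink : IsLefschetzLink g (P ++ N) h)
    {X : Type} [TopologicalSpace X] [T2Space X] [SecondCountableTopology X] [CompactSpace X]
    [ChartedSpace (EuclideanHalfSpace 4) X] [IsManifold (𝓡∂ 4) ∞ X]
    (D : MultiAttachmentData h (𝓡∂ 4) X) (bX : BoundaryData (𝓡∂ 4) X (𝓡 3))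
    (Ψ : bX.carrier ≃ₘ⟮𝓡 3, 𝓡 3⟯ (bBase g).carrier)
    (hpage : ∀ (y : bX.carrier) (a : ↥(coresComplement h)), bX.incl y = D.jA a →
      ∃ c : ℝ, 0 < c ∧ w g ((bBase g).incl (Ψ y)).1 = (c : ℂ) * w g (a : Base g).1)
    {W₂ : Type} [TopologicalSpace W₂] [ChartedSpace (EuclideanHalfSpace 4) W₂]
    (col : (BoundaryManifold.boundaryData 3 (Base g)).Collar) (κ δ : ℝ) (hκ : 0 < κ) (hκ1 : κ ≤ 1)
    (hδ : 0 < δ) (hδ2 : δ ≤ 1 / 2)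
    (D₂ : MultiAttachmentData (fun j : Fin N.length => dualMap D bX (bBase g) Ψ col κ δ hκ hκ1 hδ hδ2
      (Fin.cast List.length_append.symm (Fin.natAdd P.length j))) (𝓡∂ 4) W₂)
    (hN0 : ∀ x ∈ N, x.1 ≠ 0) :
    ∃ (m : ℝ) (hm : 0 < m)
      (D₂p : MultiAttachmentData (fun j : Fin N.length =>
        (dualMap D bX (bBase g) Ψ col κ δ hκ hκ1 hδ hδ2
          (Fin.cast List.length_append.symm (Fin.natAdd P.length j))).transport
          ((strIso g m hm).toDiffeomorph 1)) (𝓡∂ 4) W₂),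
      (∀ (j : Fin N.length) (θ : sphere (0 : EuclideanSpace ℝ (Fin 2)) 1),
        2 * m ≤ ‖w g ((dualMap D bX (bBase g) Ψ col κ δ hκ hκ1 hδ hδ2
          (Fin.cast List.length_append.symm (Fin.natAdd P.length j))).attachingCircle θ).1‖) ∧
      (∀ a, D₂p.jA a = D₂.jA (coresComplementCongr
          (fun j : Fin N.length => dualMap D bX (bBase g) Ψ col κ δ hκ hκ1 hδ hδ2
            (Fin.cast List.length_append.symm (Fin.natAdd P.length j)))
          ((strIso g m hm).toDiffeomorph 1) a)) ∧
      (∀ j b, D₂p.jB j b = D₂.jB j b) ∧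
      (∀ (j : Fin N.length) (θ : sphere (0 : EuclideanSpace ℝ (Fin 2)) 1),
        ((dualMap D bX (bBase g) Ψ col κ δ hκ hκ1 hδ hδ2
          (Fin.cast List.length_append.symm (Fin.natAdd P.length j))).transport
          ((strIso g m hm).toDiffeomorph 1)).attachingCircle θ ∈
            page g (pageDir (P ++ N).length (P.length + j))) ∧
      (∀ j : Fin N.length, shadow g
          ((dualMap D bX (bBase g) Ψ col κ δ hκ hκ1 hδ hδ2
            (Fin.cast List.length_append.symm (Fin.natAdd P.length j))).transport
            ((strIso g m hm).toDiffeomorph 1)).attachingCircle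
          ((dualMap D bX (bBase g) Ψ col κ δ hκ hκ1 hδ hδ2
            (Fin.cast List.length_append.symm (Fin.natAdd P.length j))).transport
            ((strIso g m hm).toDiffeomorph 1)).continuous_attachingCircle ≠ 0) ∧
      (∀ ap : ↥(coresComplement fun j : Fin N.length =>
          (dualMap D bX (bBase g) Ψ col κ δ hκ hκ1 hδ hδ2
            (Fin.cast List.length_append.symm (Fin.natAdd P.length j))).transport
            ((strIso g m hm).toDiffeomorph 1)),
        ∃ (a' : ↥(coresComplement fun j : Fin N.length => dualMap D bX (bBase g) Ψ col κ δ hκ hκ1 hδ hδ2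
            (Fin.cast List.length_append.symm (Fin.natAdd P.length j)))) (c : ℝ),
          0 < c ∧ D₂p.jA ap = D₂.jA a' ∧ w g (ap : Base g).1 = (c : ℂ) * w g (a' : Base g).1) ∧
      (∀ a' : ↥(coresComplement fun j : Fin N.length => dualMap D bX (bBase g) Ψ col κ δ hκ hκ1 hδ hδ2
          (Fin.cast List.length_append.symm (Fin.natAdd P.length j))),
        ∃ ap : ↥(coresComplement fun j : Fin N.length =>
          (dualMap D bX (bBase g) Ψ col κ δ hκ hκ1 hδ hδ2
            (Fin.cast List.length_append.symm (Fin.natAdd P.length j))).transport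
            ((strIso g m hm).toDiffeomorph 1)),
          D₂p.jA ap = D₂.jA a') := by
  -- the margin and the universal straightening
  obtain ⟨m, hm, hmar⟩ := exists_dual_margin hlink D bX Ψ hpage col κ δ hκ hκ1 hδ hδ2
  -- transport of the dual data along the time-`1` map, with the bridges
  obtain ⟨D₂p, hA, hB, R1, R2⟩ := transport_bridges
    (fun j : Fin N.length => dualMap D bX (bBase g) Ψ col κ δ hκ hκ1 hδ hδ2
      (Fin.cast List.length_append.symm (Fin.natAdd P.length j)))
    D₂ ((strIso g m hm).toDiffeomorph 1) (fun x => str_dir_base m hm 1 x)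
  exact ⟨m, hm, D₂p, fun j θ => hmar _ θ, hA, hB,
    fun j θ => transport_dual_circle_mem_page_sfx hlink D bX Ψ hpage col κ δ hκ hκ1 hδ hδ2 hm hmar j θ,
    fun j => shadow_transport_dualMap_sfx_ne_zero hlink D bX Ψ hpage col κ δ hκ hκ1 hδ hδ2 hN0 _ 1 j,
    R1, R2⟩

/-! ## §4 Registered helper -/

/-- **Sub-goal `helper_transport_bridges` of stub `stub_T3_dualPresentation`** (node Hgap, part A-2; wave 6,
lead c5): transport of multi-attachment data of handles on the cap `Base g` along a `w`-proportional
diffeomorphism `G` of the cap — the `jA`-formula `D₂p.jA = D₂.jA ∘ G⁻¹`, `D₂p.jB = D₂.jB`, and the two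
`w`-bridges (R1p), (R2p) of Hgap. [cite: Kosinski1993, VI §6 and VIII proof of (1.2)] -/
theorem helper_transport_bridges : ∀ (g : ℕ) (ι : Type) [Finite ι] (q : ι → Literature.Topology.FourManifolds.HandleAttachingMap 3 2 (Literature.Topology.FourManifolds.LefschetzBase.Base g)) (W₂ : Type) [TopologicalSpace W₂] [ChartedSpace (EuclideanHalfSpace 4) W₂] (D₂ : Literature.Topology.FourManifolds.HandleAttachingMap.MultiAttachmentData q (𝓡∂ 4) W₂) (G : Literature.Topology.FourManifolds.LefschetzBase.Base g ≃ₘ⟮𝓡∂ 4, 𝓡∂ 4⟯ Literature.Topology.FourManifolds.LefschetzBase.Base g), (∀ x : Literature.Topology.FourManifolds.LefschetzBase.Base g, ∃ r : ℝ, 0 < r ∧ Literature.Topology.FourManifolds.LefschetzBase.w g (G x).1 = (r : ℂ) * Literature.Topology.FourManifolds.LefschetzBase.w g x.1) → ∃ D₂p : Literature.Topology.FourManifolds.HandleAttachingMap.MultiAttachmentData (fun i => (q i).transport G) (𝓡∂ 4) W₂, (∀ a, D₂p.jA a = D₂.jA (Literature.Topology.FourManifolds.HandleAttachingMap.coresComplementCongr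 q G a)) ∧ (∀ i b, D₂p.jB i b = D₂.jB i b) ∧ (∀ ap : ↥(Literature.Topology.FourManifolds.HandleAttachingMap.coresComplement fun i => (q i).transport G), ∃ (a' : ↥(Literature.Topology.FourManifolds.HandleAttachingMap.coresComplement q)) (c : ℝ), 0 < c ∧ D₂p.jA ap = D₂.jA a' ∧ Literature.Topology.FourManifolds.LefschetzBase.w g (ap : Literature.Topology.FourManifolds.LefschetzBase.Base g).1 = (c : ℂ) * Literature.Topology.FourManifolds.LefschetzBase.w g (a' : Literature.Topology.FourManifolds.LefschetzBase.Base g).1) ∧ (∀ a' : ↥(Literature.Topology.FourManifolds.HandleAttachingMap.coresComplement q), ∃ ap : ↥(Literature.Topology.FourManifolds.HandleAttachingMap.coresComplement fun i => (q i).transport G), D₂p.jA ap = D₂.jA a') := by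
  intro g ι _ q W₂ _ _ D₂ G hw
  exact transport_bridges q D₂ G hw

end Summit.SmoothPoincare4.SmoothPoincare4.Theorems.AcyclicBisectionExists.ModpBraidOrbits

end
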